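import Literature.AlgebraicGeometry.Frobenioids.PadicFrobenioidPairIso
import HarnessLib

/-!
# Frobenioids II, Thm. 2.4: the `Π`-isomorphism of the pair "lies over" an isomorphism of the faithful quotients

Mochizuki, *The geometry of Frobenioids II*, Kyushu J. Math. **62** (2008) 401–460, §2, Theorem 2.4, preamble,
author's text p. 19 [cite: MochizukiFrdII2008, Thm 2.4 p.19]: "`Ψ` … necessarily induces a 1-compatible equivalence
of categories `Ψ^Base : D₁ ⥲ D₂`, hence an outer isomorphism of topological groups `Π₁ ⥲ Π₂` … that lies over an outer
isomorphism of topological groups `G₁ ⥲ G₂` (cf. Theorem 1.2(ii))"; proof of (ii), p. 21: "a pair of compatible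
isomorphisms `G₁ ⥲ G₂`; `K̄₁^× ⥲ K̄₂^×`".

PROOF-ONLY (cell abc-iut, `plan/L1/SUBDAG-FrdII-Thm24.md` row W12-L17; audit nit D-1 of abc-iut-w5-d229 on p422264).
abc-iut-w5-d194's `BaseGaloisSystem.exists_pairIso` delivers the pair at the `Π`-level: `φ : Π₁ ≃* Π₂` and a
`φ`-EQUIVARIANT `e : lim→ K₁^× ≅ lim→ K₂^×` (deck actions `r_g` along the universal pro-coverings).  Print's `Gᵢ` is
the quotient of `Πᵢ` acting faithfully on `K̄ᵢ^×` (`Gᵢ = Im(Πᵢ → G_{ℚ_{pᵢ}})`).  For ANY `φ`-equivariant pair and ANY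
coefficient functors `F₁`, `F₂` this file proves that `φ` respects the kernels of the two actions on the direct limits
and therefore descends to the faithful quotients — the kernel content of "lies over `G₁ ⥲ G₂`" / "compatible":

* `BaseGaloisSystem.colimMap_toAutCoset_eq_id_iff_of_equivariant` — `r_g` acts trivially on `lim→ F₁` iff `r_{φ g}`
  acts trivially on `lim→ F₂`;
* `BaseGaloisSystem.exists_quotient_mulEquiv_of_equivariant` — hence there are normal subgroups `K₁ ⊴ Π₁`, `K₂ ⊴ Π₂`,
  EQUAL to the kernels of the actions, with `φ(K₁) = K₂` and `Π₁/K₁ ≃* Π₂/K₂`.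
The identification `Πᵢ/Kᵢ = Im(Πᵢ → G_{ℚ_{pᵢ}})` at the genuine base functor is not typed here.
Theorems only; no new definitions; nothing here bears on [IUTchIII] Cor. 3.12.
-/

noncomputable section

namespace Literature.AlgebraicGeometry.Frobenioids

open CategoryTheory CategoryTheory.Limits Opposite Topology Filter
open Literature.AnabelianGeometry.SemiGraphs

universe v₃ u₃ u

namespace BaseGaloisSystem

section Action

variable {G : Type u} [Group G] [TopologicalSpace G] (N : ℕ → OpenNormalSubgroup G) (hN : Antitone N)
  {C : Type u₃} [Category.{v₃} C] (F : (CosetCat G)ᵒᵖ ⥤ C) [HasColimit (cosetSystem N hN ⋙ F)]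

/-- `colimMap` along the universal pro-covering is multiplicative in the natural transformation (only `HasColimit` of
the one diagram is needed). [cite: MochizukiFrdII2008, Thm 2.4 (ii) p.21] -/
theorem colimMap_comp_cosetSystem (α β : cosetSystem N hN ⟶ cosetSystem N hN) :
    colimMap (Functor.whiskerRight (α ≫ β) F) =
      colimMap (Functor.whiskerRight α F) ≫ colimMap (Functor.whiskerRight β F) := by
  refine colimit.hom_ext fun j => ?_
  simp only [ι_colimMap, ι_colimMap_assoc, Functor.whiskerRight_app, NatTrans.comp_app, Functor.map_comp]
  erw [Category.assoc]
  rfl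

/-- … and unital. [cite: MochizukiFrdII2008, Thm 2.4 (ii) p.21] -/
theorem colimMap_id_cosetSystem :
    colimMap (Functor.whiskerRight (𝟙 (cosetSystem N hN)) F) = 𝟙 (colimit (cosetSystem N hN ⋙ F)) := by
  refine colimit.hom_ext fun j => ?_
  simp only [ι_colimMap, Functor.whiskerRight_app, NatTrans.id_app, Category.comp_id]
  erw [F.map_id]
  exact Category.id_comp _

/-- **The deck action of `Π` on `lim→_k F(Π/N_k)` is a monoid action** (`g ↦` the map induced by `r_g`), packaged as
the existence of a homomorphism `Π → End(lim→ F)` computing it (`End` multiplies by `f * g = g ≫ f`, matching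
`Aut (cosetSystem N)`'s `σ * τ = τ ≪≫ σ`). [cite: MochizukiFrdII2008, Thm 2.4 (ii) p.21] -/
theorem exists_endHom_colimMap_toAutCoset :
    ∃ ρ : G →* End (colimit (cosetSystem N hN ⋙ F)),
      ∀ g : G, ρ g = colimMap (Functor.whiskerRight (toAutCoset N hN g).hom F) := by
  refine ⟨{ toFun := fun g => colimMap (Functor.whiskerRight (toAutCoset N hN g).hom F)
            map_one' := ?_, map_mul' := fun g h => ?_ }, fun g => rfl⟩
  · change colimMap (Functor.whiskerRight (toAutCoset N hN 1).hom F) = 𝟙 _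
    rw [map_one]
    exact colimMap_id_cosetSystem N hN F
  · change colimMap (Functor.whiskerRight (toAutCoset N hN (g * h)).hom F) =
      colimMap (Functor.whiskerRight (toAutCoset N hN h).hom F) ≫
        colimMap (Functor.whiskerRight (toAutCoset N hN g).hom F)
    rw [map_mul, Aut.Aut_mul_def, Iso.trans_hom, colimMap_comp_cosetSystem]

/-- **The kernel of the deck action on `lim→ F` is a normal subgroup**: there is `K ⊴ Π` with
`g ∈ K ↔ r_g` acts trivially on `lim→_k F(Π/N_k)`.  (At the genuine base and `F = B₀ = K^×`: `K = Ker(Π → G_{ℚ_p})`,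
`Π/K = G`.) [cite: MochizukiFrdII2008, Thm 2.4 p.19] -/
theorem exists_normal_ker_colimMap_toAutCoset :
    ∃ (K : Subgroup G), K.Normal ∧
      ∀ g : G, g ∈ K ↔ colimMap (Functor.whiskerRight (toAutCoset N hN g).hom F) = 𝟙 _ := by
  obtain ⟨ρ, hρ⟩ := exists_endHom_colimMap_toAutCoset N hN F
  refine ⟨ρ.toHomUnits.ker, inferInstance, fun g => ?_⟩
  rw [MonoidHom.mem_ker, ← hρ g, Units.ext_iff]
  rfl

end Action

section Descent

variable {G : Type u} [Group G] [TopologicalSpace G] {G₂ : Type u} [Group G₂] [TopologicalSpace G₂]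
  (N : ℕ → OpenNormalSubgroup G) (hN : Antitone N) (N₂ : ℕ → OpenNormalSubgroup G₂) (hN₂ : Antitone N₂)
  {C : Type u₃} [Category.{v₃} C]
  (F₁ : (CosetCat G)ᵒᵖ ⥤ C) (F₂ : (CosetCat G₂)ᵒᵖ ⥤ C)
  [HasColimit (cosetSystem N hN ⋙ F₁)] [HasColimit (cosetSystem N₂ hN₂ ⋙ F₂)]
  (φ : G ≃* G₂) (e : colimit (cosetSystem N hN ⋙ F₁) ≅ colimit (cosetSystem N₂ hN₂ ⋙ F₂))
  (he : ∀ g : G, e.hom ≫ colimMap (Functor.whiskerRight (toAutCoset N₂ hN₂ (φ g)).hom F₂) =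
    colimMap (Functor.whiskerRight (toAutCoset N hN g).hom F₁) ≫ e.hom)

include he in
/-- **`φ` respects the kernels of the actions.**  For a `φ`-equivariant pair `(φ, e)` ("compatible isomorphisms",
FrdII p. 21): `r_g` acts trivially on `lim→ F₁` iff `r_{φ g}` acts trivially on `lim→ F₂`.
[cite: MochizukiFrdII2008, Thm 2.4 (ii) p.21] -/
theorem colimMap_toAutCoset_eq_id_iff_of_equivariant (g : G) :
    colimMap (Functor.whiskerRight (toAutCoset N hN g).hom F₁) = 𝟙 _ ↔
      colimMap (Functor.whiskerRight (toAutCoset N₂ hN₂ (φ g)).hom F₂) = 𝟙 _ := by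
  have h := he g
  constructor
  · intro h1
    rw [h1, Category.id_comp] at h
    simpa using (cancel_epi e.hom).1 (h.trans (Category.comp_id e.hom).symm)
  · intro h2
    rw [h2, Category.comp_id] at h
    simpa using ((cancel_mono e.hom).1 (h.symm.trans (Category.id_comp e.hom).symm))

include he in
/-- **`φ` descends to the faithful quotients ("lies over `G₁ ⥲ G₂`", FrdII p. 19; "compatible", p. 21).**  For a
`φ`-equivariant pair `(φ, e)` there are normal subgroups `K₁ ⊴ Π₁`, `K₂ ⊴ Π₂` — EXACTLY the kernels of the deck
actions on `lim→ F₁`, `lim→ F₂` — with `φ(K₁) = K₂`, and `φ` induces `Π₁/K₁ ≃* Π₂/K₂`.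
[cite: MochizukiFrdII2008, Thm 2.4 p.19] -/
theorem exists_quotient_mulEquiv_of_equivariant :
    ∃ (K₁ : Subgroup G) (K₂ : Subgroup G₂) (_ : K₁.Normal) (_ : K₂.Normal),
      (∀ g : G, g ∈ K₁ ↔ colimMap (Functor.whiskerRight (toAutCoset N hN g).hom F₁) = 𝟙 _) ∧
      (∀ g : G₂, g ∈ K₂ ↔ colimMap (Functor.whiskerRight (toAutCoset N₂ hN₂ g).hom F₂) = 𝟙 _) ∧
      K₁.map φ.toMonoidHom = K₂ ∧ Nonempty (G ⧸ K₁ ≃* G₂ ⧸ K₂) := by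
  obtain ⟨K₁, hK₁n, hK₁⟩ := exists_normal_ker_colimMap_toAutCoset N hN F₁
  obtain ⟨K₂, hK₂n, hK₂⟩ := exists_normal_ker_colimMap_toAutCoset N₂ hN₂ F₂
  have hmap : K₁.map φ.toMonoidHom = K₂ := by
    ext g₂
    rw [Subgroup.mem_map_equiv, hK₁, hK₂,
      colimMap_toAutCoset_eq_id_iff_of_equivariant N hN N₂ hN₂ F₁ F₂ φ e he, MulEquiv.apply_symm_apply]
  haveI := hK₁n
  haveI := hK₂n
  exact ⟨K₁, K₂, hK₁n, hK₂n, hK₁, hK₂, hmap, ⟨QuotientGroup.congr K₁ K₂ φ hmap⟩⟩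

end Descent

end BaseGaloisSystem

end Literature.AlgebraicGeometry.Frobenioids

end
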